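import Literature.Topology.FourManifolds.TubeRound
import HarnessLib

/-!
# Exports of the rounding zone: tangential derivative, quantitative invertibility, Euler defect

Topic `Literature/Topology/FourManifolds`; sequel of `TubeRound.lean` (codimension `≥ 2` step of the
smoothing of PD homeomorphisms: Munkres, Ann. of Math. 72 (1960), §§4–5; Campbell–D'Onofrio–Vítek,
J. Geom. Anal. (2026), Lemma 3.4 Step 2).  With `φ = roundMap N r₁ ρ η`, `t = ‖y‖`,
`V = linkField N r₁ p`, `β = ‖V‖`, `q₁ = linkPoint r₁ p`, `L = DN(q₁)`, the three **pointwise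
exports** for the next stage (`ExportAlgebra.lean`) are:

* (E1) `fderiv_linkField_apply_inl`, `fderiv_roundMap_apply_inl`, `norm_fderiv_roundMap_inl_le`:
  `D V (v,0) = r₁⁻¹ • L (v,0)` and `Dφ (v, 0) = t • (c' • V + c₀ • DV(v,0))`, so
  `‖Dφ (v,0)‖ ≤ 2 t ‖DV (v,0)‖` (`ρ ≤ β`, `η ∈ [0,1]`) — factor `t`;
* (E3) `roundMap_euler_defect`, `norm_roundMap_euler_defect_le`:
  `Dφ (0, y) − φ = (t² η'(t) (1 − ρ/β)) • V`, of norm `t² η' (β − ρ) ≤ t (t η') β`;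
* (E2) `roundMap_fibre_lower_bound`: with a quantitative transversality constant `γ`
  (`u ⊥ ŷ ⟹ γ‖u‖ ≤ ‖L(0,u) − ⟪V̂, L(0,u)⟫ V̂‖`), `‖L(0,u)‖ ≤ M‖u‖`, `η ∈ [0,1]`, `η' ≥ 0`,
  `0 < ρ ≤ β`: `ρ² γ ‖w‖ ≤ (ρ γ + M β + ρ β) ‖Dφ (0, w)‖`.

Everything is proved; no definitions; no named facts.

## References

* J. R. Munkres, *Obstructions to the smoothing of piecewise-differentiable homeomorphisms*, Ann.
  of Math. (2) 72 (1960), 521–554, §§4–5. [Munkres1960]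
* D. Campbell, L. D'Onofrio, T. Vítek, *Diffeomorphic approximation of piecewise affine
  homeomorphisms*, J. Geom. Anal. 36 (2026), Lemma 3.4 (Step 2). [CampbellDonofrioVitek2026]
-/

noncomputable section

open Set Function Metric Filter
open scoped Topology ContDiff RealInnerProductSpace

namespace Literature.Topology.FourManifolds

variable {E : Type*} [NormedAddCommGroup E] [NormedSpace ℝ E]
variable {F : Type*} [NormedAddCommGroup F] [InnerProductSpace ℝ F]
variable {N : E × F → F} {r₁ ρ : ℝ} {η : ℝ → ℝ} {p : E × F}

/-- `∞ ≠ 0` (bookkeeping). [folklore] -/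
private theorem exr_infty_ne_zero : (∞ : WithTop ℕ∞) ≠ 0 := by
  simp

/-- The line `τ ↦ x + τ • v` in the parameter space. [folklore] -/
private theorem exr_hasDerivAt_line (x v : E) : HasDerivAt (fun τ : ℝ => x + τ • v) v 0 := by
  have h := ((hasDerivAt_id (0 : ℝ)).smul_const v).const_add x
  rw [one_smul] at h
  exact h

/-! ### (E1) Tangential derivatives -/

/-- **Tangential derivative of the link field**: `D(linkField)(p)(v, 0) = r₁⁻¹ • DN(q₁)(v, 0)`.
[folklore] -/
theorem fderiv_linkField_apply_inl (hp : p.2 ≠ 0) (hN : ContDiffAt ℝ ∞ N (linkPoint r₁ p)) (v : E) :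
    fderiv ℝ (linkField N r₁) p (v, 0) = r₁⁻¹ • fderiv ℝ N (linkPoint r₁ p) (v, 0) := by
  have hd : DifferentiableAt ℝ (linkField N r₁) p :=
    (contDiffAt_linkField hp hN).differentiableAt exr_infty_ne_zero
  have hline : HasDerivAt (fun τ : ℝ => ((p.1 + τ • v, p.2) : E × F)) ((v, (0 : F)) : E × F) 0 :=
    (exr_hasDerivAt_line p.1 v).prodMk (hasDerivAt_const (0 : ℝ) p.2)
  have h1 : HasDerivAt (fun τ : ℝ => linkField N r₁ (p.1 + τ • v, p.2))
      (fderiv ℝ (linkField N r₁) p (v, 0)) 0 :=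
    hd.hasFDerivAt.comp_hasDerivAt_of_eq (0 : ℝ) hline (by simp)
  have hq : HasDerivAt (fun τ : ℝ => ((p.1 + τ • v, (r₁ / ‖p.2‖) • p.2) : E × F)) ((v, (0 : F)) : E × F) 0 :=
    (exr_hasDerivAt_line p.1 v).prodMk (hasDerivAt_const (0 : ℝ) _)
  have hNd : HasFDerivAt N (fderiv ℝ N (linkPoint r₁ p)) (linkPoint r₁ p) :=
    (hN.differentiableAt exr_infty_ne_zero).hasFDerivAt
  have h2' : HasDerivAt (fun τ : ℝ => N (p.1 + τ • v, (r₁ / ‖p.2‖) • p.2))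
      (fderiv ℝ N (linkPoint r₁ p) (v, 0)) 0 :=
    hNd.comp_hasDerivAt_of_eq (0 : ℝ) hq (by simp [linkPoint])
  have h2 : HasDerivAt (fun τ : ℝ => linkField N r₁ (p.1 + τ • v, p.2))
      (r₁⁻¹ • fderiv ℝ N (linkPoint r₁ p) (v, 0)) 0 := h2'.const_smul r₁⁻¹
  exact h1.unique h2

/-- **Tangential derivative of the rounding map**:
`Dφ (v, 0) = t • ((−(1 − η t) ρ ⟪β⁻¹ • V, V'⟫ / β²) • V + c₀ • V')`, `V' = D V (v, 0)`,
`c₀ = (1 − η t)ρ/β + η t`. [folklore] -/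
theorem fderiv_roundMap_apply_inl (hp : p.2 ≠ 0) (hN : ContDiffAt ℝ ∞ N (linkPoint r₁ p))
    (hV : linkField N r₁ p ≠ 0) (hη : ContDiffAt ℝ ∞ η ‖p.2‖) (v : E) :
    fderiv ℝ (roundMap N r₁ ρ η) p (v, 0) =
      ‖p.2‖ • ((-((1 - η ‖p.2‖) * ρ *
            ⟪‖linkField N r₁ p‖⁻¹ • linkField N r₁ p, fderiv ℝ (linkField N r₁) p (v, 0)⟫ /
              ‖linkField N r₁ p‖ ^ 2)) • linkField N r₁ p +
        ((1 - η ‖p.2‖) * ρ / ‖linkField N r₁ p‖ + η ‖p.2‖) • fderiv ℝ (linkField N r₁) p (v, 0)) := by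
  set t : ℝ := ‖p.2‖ with ht
  set V₀ : F := linkField N r₁ p with hV₀
  set β : ℝ := ‖V₀‖ with hβ
  have hβ0 : β ≠ 0 := norm_ne_zero_iff.2 hV
  set V' : F := fderiv ℝ (linkField N r₁) p (v, 0) with hV'
  set e : ℝ := η t with he
  -- (1) along the line `τ ↦ (x + τ v, y)`
  have hd : DifferentiableAt ℝ (roundMap N r₁ ρ η) p :=
    (contDiffAt_roundMap hp hN hV hη).differentiableAt exr_infty_ne_zero
  have hline : HasDerivAt (fun τ : ℝ => ((p.1 + τ • v, p.2) : E × F)) ((v, (0 : F)) : E × F) 0 :=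
    (exr_hasDerivAt_line p.1 v).prodMk (hasDerivAt_const (0 : ℝ) p.2)
  have h1 : HasDerivAt (fun τ : ℝ => roundMap N r₁ ρ η (p.1 + τ • v, p.2))
      (fderiv ℝ (roundMap N r₁ ρ η) p (v, 0)) 0 :=
    hd.hasFDerivAt.comp_hasDerivAt_of_eq (0 : ℝ) hline (by simp)
  -- (2) the pieces: `V(τ)`, `β(τ)`, `c(τ)`; the radius `‖y‖` is constant along the line
  have hVd : DifferentiableAt ℝ (linkField N r₁) p :=
    (contDiffAt_linkField hp hN).differentiableAt exr_infty_ne_zero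
  have hVτ : HasDerivAt (fun τ : ℝ => linkField N r₁ (p.1 + τ • v, p.2)) V' 0 :=
    hVd.hasFDerivAt.comp_hasDerivAt_of_eq (0 : ℝ) hline (by simp)
  have hVv0 : linkField N r₁ (p.1 + (0 : ℝ) • v, p.2) = V₀ := by rw [zero_smul, add_zero]
  have hβτ : HasDerivAt (fun τ : ℝ => ‖linkField N r₁ (p.1 + τ • v, p.2)‖) ⟪β⁻¹ • V₀, V'⟫ 0 := by
    have h0 : linkField N r₁ (p.1 + (0 : ℝ) • v, p.2) ≠ 0 := by rw [hVv0]; exact hV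
    have := (hasStrictFDerivAt_norm_sq (linkField N r₁ (p.1 + (0 : ℝ) • v, p.2))).hasFDerivAt
    -- use the norm derivative through `TubeRound`'s private copy indirectly: differentiate `‖·‖`
    -- as `ContDiffAt` and identify the value via the squared norm
    have hn : HasDerivAt (fun τ : ℝ => ‖linkField N r₁ (p.1 + τ • v, p.2)‖ ^ 2)
        (2 * ⟪V₀, V'⟫) 0 := by
      have h := hVτ.norm_sq
      rw [hVv0] at h
      exact h
    have hsq : HasDerivAt (fun τ : ℝ => ‖linkField N r₁ (p.1 + τ • v, p.2)‖)
        (deriv (fun τ : ℝ => ‖linkField N r₁ (p.1 + τ • v, p.2)‖) 0) 0 := by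
      have hc : DifferentiableAt ℝ (fun τ : ℝ => ‖linkField N r₁ (p.1 + τ • v, p.2)‖) 0 :=
        (hVτ.differentiableAt.norm ℝ h0)
      exact hc.hasDerivAt
    -- identify the derivative: `2 β d = 2 ⟪V₀, V'⟫`
    have hprod := hsq.mul hsq
    have h2 : deriv (fun τ : ℝ => ‖linkField N r₁ (p.1 + τ • v, p.2)‖) 0 * β +
        β * deriv (fun τ : ℝ => ‖linkField N r₁ (p.1 + τ • v, p.2)‖) 0 = 2 * ⟪V₀, V'⟫ := by
      have hfun : (fun τ : ℝ => ‖linkField N r₁ (p.1 + τ • v, p.2)‖ ^ 2) =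
          fun τ => ‖linkField N r₁ (p.1 + τ • v, p.2)‖ * ‖linkField N r₁ (p.1 + τ • v, p.2)‖ := by
        funext τ; ring
      rw [hfun] at hn
      have := hprod.unique hn
      rw [hVv0] at this
      linarith
    have hval : deriv (fun τ : ℝ => ‖linkField N r₁ (p.1 + τ • v, p.2)‖) 0 = ⟪β⁻¹ • V₀, V'⟫ := by
      rw [real_inner_smul_left]
      field_simp
      linarith
    rw [← hval]
    exact hsq
  have hc : HasDerivAt (fun τ : ℝ =>
      (1 - η ‖p.2‖) * ρ / ‖linkField N r₁ (p.1 + τ • v, p.2)‖ + η ‖p.2‖)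
      (-((1 - e) * ρ * ⟪β⁻¹ • V₀, V'⟫) / β ^ 2) 0 := by
    have h := ((hasDerivAt_const (0 : ℝ) ((1 - η ‖p.2‖) * ρ)).fun_div hβτ (by rw [hVv0]; exact hβ0))
    rw [hVv0] at h
    have h' := h.add_const (η ‖p.2‖)
    refine h'.congr_deriv ?_
    rw [← hβ, zero_mul, zero_sub]
  have h2 : HasDerivAt (fun τ : ℝ => roundMap N r₁ ρ η (p.1 + τ • v, p.2))
      ((t * (-((1 - e) * ρ * ⟪β⁻¹ • V₀, V'⟫) / β ^ 2)) • V₀ +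
        (t * ((1 - e) * ρ / β + e)) • V') 0 := by
    have hsc := hc.const_mul t
    have := hsc.fun_smul hVτ
    rw [hVv0, add_comm] at this
    refine this.congr_deriv ?_
    rw [← hβ]
  rw [h1.unique h2, smul_add, smul_smul, smul_smul]
  congr 2
  ring

/-- **Norm bound for the tangential derivative of the rounding map**: with `0 ≤ ρ ≤ β`,
`η t ∈ [0, 1]`: `‖Dφ (v, 0)‖ ≤ 2 t ‖DV (v, 0)‖`. [folklore] -/
theorem norm_fderiv_roundMap_inl_le (hp : p.2 ≠ 0) (hN : ContDiffAt ℝ ∞ N (linkPoint r₁ p))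
    (hV : linkField N r₁ p ≠ 0) (hη : ContDiffAt ℝ ∞ η ‖p.2‖) (hη01 : η ‖p.2‖ ∈ Icc (0 : ℝ) 1)
    (hρ : 0 ≤ ρ) (hρV : ρ ≤ ‖linkField N r₁ p‖) (v : E) :
    ‖fderiv ℝ (roundMap N r₁ ρ η) p (v, 0)‖ ≤ 2 * ‖p.2‖ * ‖fderiv ℝ (linkField N r₁) p (v, 0)‖ := by
  rw [fderiv_roundMap_apply_inl hp hN hV hη v, norm_smul, Real.norm_of_nonneg (norm_nonneg p.2),
    mul_comm (2 : ℝ) ‖p.2‖, mul_assoc ‖p.2‖ (2 : ℝ)]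
  refine mul_le_mul_of_nonneg_left ?_ (norm_nonneg p.2)
  set V₀ : F := linkField N r₁ p with hV₀
  set β : ℝ := ‖V₀‖ with hβ
  have hβ0 : 0 < β := norm_pos_iff.2 hV
  set V' : F := fderiv ℝ (linkField N r₁) p (v, 0) with hV'
  set e : ℝ := η ‖p.2‖ with he
  have hρβ : ρ / β ≤ 1 := (div_le_one hβ0).2 hρV
  have hin : |⟪β⁻¹ • V₀, V'⟫| ≤ ‖V'‖ := by
    have h := abs_real_inner_le_norm (β⁻¹ • V₀) V'
    rwa [norm_smul, norm_inv, norm_norm, ← hβ, inv_mul_cancel₀ hβ0.ne', one_mul] at h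
  -- first term: `(1−e) ρ |⟪V̂, V'⟫| / β² · β ≤ ‖V'‖`
  have h1 : ‖(-((1 - e) * ρ * ⟪β⁻¹ • V₀, V'⟫ / β ^ 2)) • V₀‖ ≤ ‖V'‖ := by
    rw [norm_smul, Real.norm_eq_abs, abs_neg, abs_div, abs_mul, abs_mul, abs_of_nonneg (by linarith [hη01.2] : (0:ℝ) ≤ 1 - e),
      abs_of_nonneg hρ, abs_of_pos (pow_pos hβ0 2), ← hβ]
    have : (1 - e) * ρ * |⟪β⁻¹ • V₀, V'⟫| / β ^ 2 * β = ((1 - e) * (ρ / β)) * |⟪β⁻¹ • V₀, V'⟫| := by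
      field_simp
    rw [this]
    have h2 : (1 - e) * (ρ / β) ≤ 1 := by nlinarith [hη01.1, hη01.2, div_nonneg hρ hβ0.le]
    calc (1 - e) * (ρ / β) * |⟪β⁻¹ • V₀, V'⟫| ≤ 1 * |⟪β⁻¹ • V₀, V'⟫| :=
          mul_le_mul_of_nonneg_right h2 (abs_nonneg _)
      _ ≤ ‖V'‖ := by rw [one_mul]; exact hin
  -- second term: `c₀ ≤ 1`
  have h2 : ‖((1 - e) * ρ / β + e) • V'‖ ≤ ‖V'‖ := by
    rw [norm_smul, Real.norm_eq_abs]
    have hc0 : 0 ≤ (1 - e) * ρ / β + e :=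
      add_nonneg (div_nonneg (mul_nonneg (by linarith [hη01.2]) hρ) hβ0.le) hη01.1
    have hc1 : (1 - e) * ρ / β + e ≤ 1 := by
      have : (1 - e) * ρ / β = (1 - e) * (ρ / β) := by ring
      rw [this]; nlinarith [hη01.1, hη01.2, div_nonneg hρ hβ0.le]
    rw [abs_of_nonneg hc0]
    calc ((1 - e) * ρ / β + e) * ‖V'‖ ≤ 1 * ‖V'‖ := mul_le_mul_of_nonneg_right hc1 (norm_nonneg _)
      _ = ‖V'‖ := one_mul _
  calc ‖(-((1 - e) * ρ * ⟪β⁻¹ • V₀, V'⟫ / β ^ 2)) • V₀ + ((1 - e) * ρ / β + e) • V'‖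
      ≤ ‖(-((1 - e) * ρ * ⟪β⁻¹ • V₀, V'⟫ / β ^ 2)) • V₀‖ + ‖((1 - e) * ρ / β + e) • V'‖ := norm_add_le _ _
    _ ≤ ‖V'‖ + ‖V'‖ := add_le_add h1 h2
    _ = 2 * ‖V'‖ := by ring

/-! ### (E3) The Euler defect -/

/-- **Euler defect of the rounding map**: `Dφ (0, y) − φ = (t² η'(t) (1 − ρ/β)) • V`.
[folklore] -/
theorem roundMap_euler_defect (hp : p.2 ≠ 0) (hr : r₁ ≠ 0) (hN : ContDiffAt ℝ ∞ N (linkPoint r₁ p))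
    (hV : linkField N r₁ p ≠ 0) (hη : ContDiffAt ℝ ∞ η ‖p.2‖) :
    fderiv ℝ (roundMap N r₁ ρ η) p (0, p.2) - roundMap N r₁ ρ η p =
      (‖p.2‖ ^ 2 * deriv η ‖p.2‖ * (1 - ρ / ‖linkField N r₁ p‖)) • linkField N r₁ p := by
  have ht0 : 0 < ‖p.2‖ := norm_pos_iff.2 hp
  -- the fibre derivative of `V` along `y` vanishes
  have hyy : ⟪‖p.2‖⁻¹ • p.2, p.2⟫ = ‖p.2‖ := by
    rw [real_inner_smul_left, real_inner_self_eq_norm_sq, pow_two, ← mul_assoc,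
      inv_mul_cancel₀ ht0.ne', one_mul]
  have hU : fderiv ℝ (linkField N r₁) p (0, p.2) = 0 := by
    rw [fderiv_linkField_apply_inr hp hr hN p.2, hyy, smul_smul, mul_inv_cancel₀ ht0.ne', one_smul,
      sub_self]
    have : (((0 : E), (0 : F)) : E × F) = 0 := rfl
    rw [this, map_zero, smul_zero]
  rw [fderiv_roundMap_apply_inr hp hN hV hη p.2, hU, hyy, inner_zero_right, mul_zero, zero_div,
    sub_zero, smul_zero, add_zero, roundMap, ← sub_smul]
  congr 1
  ring

/-- Norm form of (E3): `‖Dφ (0, y) − φ‖ = t² η' (β − ρ) ≤ t (t η') β` for `η' ≥ 0`,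
`0 ≤ ρ ≤ β`. [folklore] -/
theorem norm_roundMap_euler_defect_le (hp : p.2 ≠ 0) (hr : r₁ ≠ 0) (hN : ContDiffAt ℝ ∞ N (linkPoint r₁ p))
    (hV : linkField N r₁ p ≠ 0) (hη : ContDiffAt ℝ ∞ η ‖p.2‖) (hη' : 0 ≤ deriv η ‖p.2‖)
    (hρ : 0 ≤ ρ) (hρV : ρ ≤ ‖linkField N r₁ p‖) :
    ‖fderiv ℝ (roundMap N r₁ ρ η) p (0, p.2) - roundMap N r₁ ρ η p‖ ≤
      ‖p.2‖ * (‖p.2‖ * deriv η ‖p.2‖) * ‖linkField N r₁ p‖ := by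
  rw [roundMap_euler_defect hp hr hN hV hη, norm_smul, Real.norm_eq_abs]
  have hβ0 : 0 < ‖linkField N r₁ p‖ := norm_pos_iff.2 hV
  have h1 : 0 ≤ 1 - ρ / ‖linkField N r₁ p‖ := by rw [sub_nonneg, div_le_one hβ0]; exact hρV
  have h2 : 1 - ρ / ‖linkField N r₁ p‖ ≤ 1 := by linarith [div_nonneg hρ hβ0.le]
  rw [abs_of_nonneg (mul_nonneg (mul_nonneg (sq_nonneg _) hη') h1)]
  have h3 : ‖p.2‖ ^ 2 * deriv η ‖p.2‖ * (1 - ρ / ‖linkField N r₁ p‖) ≤ ‖p.2‖ ^ 2 * deriv η ‖p.2‖ :=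
    mul_le_of_le_one_right (mul_nonneg (sq_nonneg _) hη') h2
  calc ‖p.2‖ ^ 2 * deriv η ‖p.2‖ * (1 - ρ / ‖linkField N r₁ p‖) * ‖linkField N r₁ p‖
      ≤ ‖p.2‖ ^ 2 * deriv η ‖p.2‖ * ‖linkField N r₁ p‖ := mul_le_mul_of_nonneg_right h3 hβ0.le
    _ = ‖p.2‖ * (‖p.2‖ * deriv η ‖p.2‖) * ‖linkField N r₁ p‖ := by ring

/-! ### (E2) Quantitative fibre invertibility -/

/-- Pythagoras for a unit vector: if `‖n‖ = 1` and `⟪n, z⟫ = 0` then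
`‖α • n + z‖ ^ 2 = α ^ 2 + ‖z‖ ^ 2`, hence `|α| ≤ ‖α • n + z‖` and `‖z‖ ≤ ‖α • n + z‖`.
[folklore] -/
theorem abs_le_and_norm_le_of_orthogonal {n z : F} (hn : ‖n‖ = 1) (hz : ⟪n, z⟫ = 0) (α : ℝ) :
    |α| ≤ ‖α • n + z‖ ∧ ‖z‖ ≤ ‖α • n + z‖ := by
  have horth : ⟪α • n, z⟫ = 0 := by rw [real_inner_smul_left, hz, mul_zero]
  have hpy : ‖α • n + z‖ * ‖α • n + z‖ = ‖α • n‖ * ‖α • n‖ + ‖z‖ * ‖z‖ :=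
    norm_add_sq_eq_norm_sq_add_norm_sq_of_inner_eq_zero _ _ horth
  have hαn : ‖α • n‖ = |α| := by rw [norm_smul, Real.norm_eq_abs, hn, mul_one]
  rw [hαn] at hpy
  have h0 : 0 ≤ ‖α • n + z‖ := norm_nonneg _
  constructor
  · nlinarith [abs_nonneg α, norm_nonneg z]
  · nlinarith [abs_nonneg α, norm_nonneg z]

/-- **(E2) Quantitative fibre invertibility of the rounding map.** Let `y ≠ 0`, `r₁ > 0`, `N`
smooth at the link point `q₁` with `V = linkField N r₁ p ≠ 0`, `β = ‖V‖`, `V̂ = β⁻¹ V`,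
`L = DN(q₁)`; let the profile be monotone with values in `[0,1]` (`η t ∈ [0,1]`, `η'(t) ≥ 0`) and
`0 < ρ ≤ β`; and assume the link is **quantitatively transversal** at `q₁`:
`u ⊥ ŷ ⟹ γ ‖u‖ ≤ ‖L(0,u) − ⟪V̂, L(0,u)⟫ V̂‖` (`γ > 0`), with `‖L(0,u)‖ ≤ M ‖u‖` (`M ≥ 0`).
Then for every `w`: `ρ² γ ‖w‖ ≤ (ρ γ + M β + ρ β) ‖Dφ (0, w)‖`.  Proof: write
`Dφ(0,w) = α • V̂ + c₀ • z⊥` with `z = L(0,u)`, `u = w − aŷ`, `z⊥ ⟂ V̂`,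
`α = a β B + η ⟪V̂, z⟫`, `B = c₀ + t η'(1−ρ/β) ≥ c₀ ≥ ρ/β`; Pythagoras bounds `c₀ γ ‖u‖` and
`|α|` by `‖Dφ(0,w)‖`, whence `ρ|a| ≤ ‖Dφ(0,w)‖ + M‖u‖`, `ρ γ ‖u‖ ≤ β ‖Dφ(0,w)‖`, and
`‖w‖ ≤ |a| + ‖u‖`. [folklore] -/
theorem roundMap_fibre_lower_bound (hp : p.2 ≠ 0) (hr : 0 < r₁) (hN : ContDiffAt ℝ ∞ N (linkPoint r₁ p))
    (hV : linkField N r₁ p ≠ 0) (hη : ContDiffAt ℝ ∞ η ‖p.2‖) (hη01 : η ‖p.2‖ ∈ Icc (0 : ℝ) 1)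
    (hη' : 0 ≤ deriv η ‖p.2‖) (hρ : 0 < ρ) (hρV : ρ ≤ ‖linkField N r₁ p‖) {γ M : ℝ} (hγ : 0 < γ)
    (hM0 : 0 ≤ M)
    (htrq : ∀ u : F, ⟪u, ‖p.2‖⁻¹ • p.2⟫ = 0 →
      γ * ‖u‖ ≤ ‖fderiv ℝ N (linkPoint r₁ p) (0, u) -
        ⟪‖linkField N r₁ p‖⁻¹ • linkField N r₁ p, fderiv ℝ N (linkPoint r₁ p) (0, u)⟫ •
          (‖linkField N r₁ p‖⁻¹ • linkField N r₁ p)‖)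
    (hM : ∀ u : F, ‖fderiv ℝ N (linkPoint r₁ p) (0, u)‖ ≤ M * ‖u‖) (w : F) :
    ρ ^ 2 * γ * ‖w‖ ≤
      (ρ * γ + M * ‖linkField N r₁ p‖ + ρ * ‖linkField N r₁ p‖) * ‖fderiv ℝ (roundMap N r₁ ρ η) p (0, w)‖ := by
  -- notation (introduced AFTER unfolding the formula, so that it folds)
  have hform := fderiv_roundMap_apply_inr (ρ := ρ) hp hN hV hη w
  have hUform := fderiv_linkField_apply_inr hp hr.ne' hN w
  rw [hUform] at hform
  set t : ℝ := ‖p.2‖ with ht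
  have ht0 : 0 < t := norm_pos_iff.2 hp
  set V₀ : F := linkField N r₁ p with hV₀
  set β : ℝ := ‖V₀‖ with hβ
  have hβ0 : 0 < β := norm_pos_iff.2 hV
  set yh : F := ‖p.2‖⁻¹ • p.2 with hyh
  set a : ℝ := ⟪yh, w⟫ with ha
  set u : F := w - a • yh with hu
  set L := fderiv ℝ N (linkPoint r₁ p) with hL
  set z : F := L (0, u) with hz
  set Vh : F := β⁻¹ • V₀ with hVh
  set e : ℝ := η t with he
  set e' : ℝ := deriv η t with he'
  set c₀ : ℝ := (1 - e) * ρ / β + e with hc₀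
  set B : ℝ := c₀ + t * (e' * (1 - ρ / β)) with hB
  set D : F := fderiv ℝ (roundMap N r₁ ρ η) p (0, w) with hD
  -- unit facts
  have hyh1 : ‖yh‖ = 1 := by rw [hyh, norm_smul, norm_inv, norm_norm, inv_mul_cancel₀ ht0.ne']
  have hVh1 : ‖Vh‖ = 1 := by rw [hVh, norm_smul, norm_inv, norm_norm, ← hβ, inv_mul_cancel₀ hβ0.ne']
  have hV₀eq : V₀ = β • Vh := by rw [hVh, smul_smul, mul_inv_cancel₀ hβ0.ne', one_smul]
  have hu_perp : ⟪u, yh⟫ = 0 := by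
    have h1 : ⟪yh, yh⟫ = 1 := by rw [real_inner_self_eq_norm_sq, hyh1, one_pow]
    rw [hu, inner_sub_left, real_inner_smul_left, h1, mul_one, real_inner_comm, ← ha, sub_self]
  -- elementary bounds on the coefficients
  have hρβ : ρ / β ≤ 1 := (div_le_one hβ0).2 hρV
  have hc₀ρ : ρ ≤ β * c₀ := by
    have : β * c₀ = (1 - e) * ρ + e * β := by rw [hc₀]; field_simp
    rw [this]; nlinarith [hη01.1, hη01.2]
  have hc₀0 : 0 < c₀ := by
    have : 0 < β * c₀ := lt_of_lt_of_le hρ hc₀ρ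
    exact pos_of_mul_pos_right this hβ0.le |> fun h => by nlinarith [this, hβ0]
  have hBc : c₀ ≤ B := by
    rw [hB]
    have : 0 ≤ t * (e' * (1 - ρ / β)) := mul_nonneg ht0.le (mul_nonneg hη' (by linarith))
    linarith
  have hBρ : ρ ≤ β * B := hc₀ρ.trans (mul_le_mul_of_nonneg_left hBc hβ0.le)
  -- the derivative formula in folded form: `D = (a B − (1−e) ρ ⟪Vh, z⟫ / β²) • V₀ + c₀ • z`
  have hDeq : D = (a * B - (1 - e) * ρ * ⟪Vh, z⟫ / β ^ 2) • V₀ + c₀ • z := by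
    rw [hform, inner_smul_right, smul_smul]
    have h1 : t * c₀ * t⁻¹ = c₀ := by field_simp
    rw [h1]
    congr 1
    congr 1
    rw [hB]
    field_simp
    ring
  -- decompose `z = ⟪Vh, z⟫ • Vh + zp`
  set zp : F := z - ⟪Vh, z⟫ • Vh with hzp
  have hzp_perp : ⟪Vh, zp⟫ = 0 := by
    rw [hzp, inner_sub_right, real_inner_smul_right, real_inner_self_eq_norm_sq, hVh1, one_pow, mul_one, sub_self]
  set α : ℝ := (a * B - (1 - e) * ρ * ⟪Vh, z⟫ / β ^ 2) * β + c₀ * ⟪Vh, z⟫ with hα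
  have hDdec : D = α • Vh + c₀ • zp := by
    rw [hDeq, hV₀eq, smul_smul, hzp, hα, smul_sub, add_smul, smul_smul]
    module
  have hαeq : α = a * β * B + e * ⟪Vh, z⟫ := by
    rw [hα, hc₀]
    field_simp
    ring
  -- Pythagoras
  have hpy := abs_le_and_norm_le_of_orthogonal hVh1 (by rw [real_inner_smul_right, hzp_perp, mul_zero]) α
    (z := c₀ • zp)
  rw [← hDdec] at hpy
  obtain ⟨hα_le, hczp_le⟩ := hpy
  -- (i) `c₀ γ ‖u‖ ≤ ‖D‖`
  have hu_le : c₀ * (γ * ‖u‖) ≤ ‖D‖ := by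
    have h1 : γ * ‖u‖ ≤ ‖zp‖ := htrq u hu_perp
    have h2 : ‖c₀ • zp‖ = c₀ * ‖zp‖ := by rw [norm_smul, Real.norm_of_nonneg hc₀0.le]
    calc c₀ * (γ * ‖u‖) ≤ c₀ * ‖zp‖ := mul_le_mul_of_nonneg_left h1 hc₀0.le
      _ = ‖c₀ • zp‖ := h2.symm
      _ ≤ ‖D‖ := hczp_le
  -- (ii) `|a| β B ≤ ‖D‖ + M ‖u‖`
  have ha_le : |a| * β * B ≤ ‖D‖ + M * ‖u‖ := by
    have h1 : |a * β * B| ≤ |α| + |e * ⟪Vh, z⟫| := by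
      have : a * β * B = α - e * ⟪Vh, z⟫ := by rw [hαeq]; ring
      rw [this]; exact abs_sub _ _
    have h2 : |e * ⟪Vh, z⟫| ≤ M * ‖u‖ := by
      rw [abs_mul, abs_of_nonneg hη01.1]
      have h3 : |⟪Vh, z⟫| ≤ ‖z‖ := by
        have := abs_real_inner_le_norm Vh z; rwa [hVh1, one_mul] at this
      calc e * |⟪Vh, z⟫| ≤ 1 * ‖z‖ := mul_le_mul hη01.2 h3 (abs_nonneg _) zero_le_one
        _ = ‖z‖ := one_mul _
        _ ≤ M * ‖u‖ := hM u
    have h4 : |a * β * B| = |a| * β * B := by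
      rw [abs_mul, abs_mul, abs_of_pos hβ0, abs_of_nonneg (hc₀0.le.trans hBc)]
    linarith
  -- (iii) assemble
  have hρa : ρ * |a| ≤ ‖D‖ + M * ‖u‖ := by
    have : ρ * |a| ≤ |a| * β * B := by
      have := mul_le_mul_of_nonneg_left hBρ (abs_nonneg a)
      linarith [this]
    exact this.trans ha_le
  have hρu : ρ * (γ * ‖u‖) ≤ β * ‖D‖ := by
    calc ρ * (γ * ‖u‖) ≤ β * c₀ * (γ * ‖u‖) := mul_le_mul_of_nonneg_right hc₀ρ (mul_nonneg hγ.le (norm_nonneg _))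
      _ = β * (c₀ * (γ * ‖u‖)) := by ring
      _ ≤ β * ‖D‖ := mul_le_mul_of_nonneg_left hu_le hβ0.le
  have hw_le : ‖w‖ ≤ |a| + ‖u‖ := by
    have h1 : w = a • yh + u := by rw [hu, add_sub_cancel]
    calc ‖w‖ = ‖a • yh + u‖ := by rw [← h1]
      _ ≤ ‖a • yh‖ + ‖u‖ := norm_add_le _ _
      _ = |a| + ‖u‖ := by rw [norm_smul, Real.norm_eq_abs, hyh1, mul_one]
  have hD0 : 0 ≤ ‖D‖ := norm_nonneg _
  calc ρ ^ 2 * γ * ‖w‖ ≤ ρ ^ 2 * γ * (|a| + ‖u‖) :=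
        mul_le_mul_of_nonneg_left hw_le (mul_nonneg (sq_nonneg _) hγ.le)
    _ = ρ * γ * (ρ * |a|) + ρ * (ρ * (γ * ‖u‖)) := by ring
    _ ≤ ρ * γ * (‖D‖ + M * ‖u‖) + ρ * (β * ‖D‖) :=
        add_le_add (mul_le_mul_of_nonneg_left hρa (mul_nonneg hρ.le hγ.le))
          (mul_le_mul_of_nonneg_left hρu hρ.le)
    _ = ρ * γ * ‖D‖ + M * (ρ * (γ * ‖u‖)) + ρ * β * ‖D‖ := by ring
    _ ≤ ρ * γ * ‖D‖ + M * (β * ‖D‖) + ρ * β * ‖D‖ := by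
        have := mul_le_mul_of_nonneg_left hρu hM0
        linarith
    _ = (ρ * γ + M * β + ρ * β) * ‖D‖ := by ring

end Literature.Topology.FourManifolds
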